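import Summits.Parity.BatemanHorn.Theorems.SoloInformedThinLocalI
import HarnessLib

/-!
# Thin sequences vs. Type-I/II information, XII: short-interval comparison sequences

Capstone of the `SoloInformedThin*` series.  The local forms (`SoloInformedThinLocal`,
`SoloInformedThinLocalI`) ask the comparison sequence `b` only for mass `≥ x/(4p)` on the
multiples of the primes of a short range.  Ford–Maynard's basic comparison sequences
`b_n = x/(2y) · 1_{x − y < n ≤ x}` (Lemma 4.6 with `q = 1`, `y ≤ x/2`; written here as the indicator
of the real interval `(x − y, x]` with the constant value `x/(2y)`) have this property for every
`p ≤ y/2`, by counting the multiples of `p` in `(x − y, x]`.  Hence, UNCONDITIONALLY in `b`: a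
support of size `x^{1−c}` carries no Type-II information in any window `[θ, θ + ν]` with
`θ + η < c`, and no Type-I information at any level `γ > 1 − c + η` (if `2η < c`), relative to the
short interval `(x − y, x]`, uniformly in `x^{1−η}/2 ≤ y ≤ x/2`.  With `η → 0` (`y ≍ x`) this is
the `(γ, θ, ν)`-budget `{γ ≤ 1 − c} × {θ ≥ c}` of thin supports against the standard comparison.

* `mem_Ioc_short`, `sub_one_le_card_Ioc_short`, `shortInterval_mass`, `shortInterval_height` —
  bookkeeping for `b`;
* `eventually_not_typeII_shortInterval`, `eventually_not_typeI_shortInterval`.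

References: [cite: FordMaynard2024PrimeSieves, §2.4 (p. 7, first family)]
[cite: FordMaynard2024PrimeSieves, §4.2 (Lemma 4.6)]
[cite: FordMaynard2024PrimeSieves, §1 (I), (II)].
-/

noncomputable section

open Filter Finset Real

namespace Summit.Parity.BatemanHorn.Theorems

open Literature.Barriers.Parity.FordMaynard (TypeI TypeII eventually_mul_rpow_le_rpow)

/-- The cofactors `r` with `x − y < p r ≤ x`: membership. [folklore] -/
theorem mem_Ioc_short {x y : ℝ} (hy0 : 0 ≤ y) (hyx : y ≤ x / 2) {p r : ℕ} (hp : 0 < p)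
    (hr : r ∈ Ioc ⌊(x - y) / p⌋₊ ⌊x / p⌋₊) :
    1 ≤ r ∧ r ≤ ⌊x⌋₊ ∧ x - y < (p * r : ℝ) ∧ (p * r : ℝ) ≤ x := by
  rw [mem_Ioc] at hr
  have hp' : (0 : ℝ) < p := by exact_mod_cast hp
  have hp1 : (1 : ℝ) ≤ p := by exact_mod_cast hp
  have hx : 0 ≤ x := by linarith
  have hxy : 0 ≤ (x - y) / p := div_nonneg (by linarith) hp'.le
  have h1 : (x - y) / p < r := (Nat.floor_lt hxy).mp hr.1
  have h2 : (r : ℝ) ≤ x / p := (Nat.le_floor_iff (by positivity)).mp hr.2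
  have h2' : (p * r : ℝ) ≤ x := by rwa [le_div_iff₀' hp'] at h2
  refine ⟨by omega, ?_, ?_, h2'⟩
  · have hr0 : (0 : ℝ) ≤ r := Nat.cast_nonneg _
    have : (r : ℝ) ≤ x := by nlinarith
    exact Nat.le_floor this
  · rwa [div_lt_iff₀' hp'] at h1

/-- … and there are at least `y/p − 1` of them. [folklore] -/
theorem sub_one_le_card_Ioc_short {x y : ℝ} (hy0 : 0 ≤ y) (hyx : y ≤ x / 2) {p : ℕ}
    (hp : 0 < p) : y / p - 1 ≤ ((Ioc ⌊(x - y) / p⌋₊ ⌊x / p⌋₊).card : ℝ) := by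
  have hp' : (0 : ℝ) < p := by exact_mod_cast hp
  have hle : (x - y) / p ≤ x / p := div_le_div_of_nonneg_right (by linarith) hp'.le
  have hfl : ⌊(x - y) / p⌋₊ ≤ ⌊x / p⌋₊ := Nat.floor_le_floor hle
  rw [Nat.card_Ioc, Nat.cast_sub hfl]
  have h2 : x / p - 1 < ⌊x / p⌋₊ := Nat.sub_one_lt_floor _
  have h3 : (⌊(x - y) / p⌋₊ : ℝ) ≤ (x - y) / p :=
    Nat.floor_le (div_nonneg (by linarith) hp'.le)
  have h4 : x / p - (x - y) / p = y / p := by field_simp; ring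
  linarith

/-- Ford–Maynard's basic comparison sequence `b_n = x/(2y) · 1_{x − y < n ≤ x}` (Lemma 4.6 with
`q = 1`, written as the indicator of the real interval `(x − y, x]`) puts mass `≥ x/(4p)` on the
multiples of every `p ≤ y/2` in `(x/2, x]`, for `y ≤ x/2`.
[cite: FordMaynard2024PrimeSieves, §4.2 (Lemma 4.6)] -/
theorem shortInterval_mass {x y : ℝ} {p : ℕ} (hp : 0 < p) (hpy : 2 * (p : ℝ) ≤ y)
    (hyx : y ≤ x / 2) :
    x / (4 * p) ≤ ∑ n ∈ (Icc 1 ⌊x⌋₊).filter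
      (fun n : ℕ => x / 2 < (p * n : ℝ) ∧ (p * n : ℝ) ≤ x),
        (Set.Ioc (x - y) x).indicator (fun _ : ℝ => x / (2 * y)) ((p * n : ℕ) : ℝ) := by
  have hp' : (0 : ℝ) < p := by exact_mod_cast hp
  have hy0 : 0 ≤ y := by linarith
  have hx : 0 ≤ x := by linarith
  have hxy : 0 ≤ x / (2 * y) := by positivity
  set J : Finset ℕ := Ioc ⌊(x - y) / p⌋₊ ⌊x / p⌋₊ with hJ
  set F : Finset ℕ := (Icc 1 ⌊x⌋₊).filter
    (fun n : ℕ => x / 2 < (p * n : ℝ) ∧ (p * n : ℝ) ≤ x) with hF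
  have hJF : J ⊆ F := by
    intro r hr
    obtain ⟨h1, h2, h3, h4⟩ := mem_Ioc_short hy0 hyx hp hr
    rw [hF, mem_filter, mem_Icc]
    exact ⟨⟨h1, h2⟩, by linarith, h4⟩
  have hval : ∀ r ∈ J, (Set.Ioc (x - y) x).indicator (fun _ : ℝ => x / (2 * y))
      ((p * r : ℕ) : ℝ) = x / (2 * y) := by
    intro r hr
    obtain ⟨_, _, h3, h4⟩ := mem_Ioc_short hy0 hyx hp hr
    have hmem : ((p * r : ℕ) : ℝ) ∈ Set.Ioc (x - y) x := by
      rw [Set.mem_Ioc]; push_cast; exact ⟨h3, h4⟩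
    exact Set.indicator_of_mem hmem _
  have hsub : ∑ n ∈ J, (Set.Ioc (x - y) x).indicator (fun _ : ℝ => x / (2 * y))
      ((p * n : ℕ) : ℝ) ≤ ∑ n ∈ F, (Set.Ioc (x - y) x).indicator (fun _ : ℝ => x / (2 * y))
      ((p * n : ℕ) : ℝ) :=
    sum_le_sum_of_subset_of_nonneg hJF
      (fun n _ _ => Set.indicator_nonneg (fun _ _ => hxy) _)
  rw [sum_congr rfl hval, sum_const, nsmul_eq_mul] at hsub
  have hcard := sub_one_le_card_Ioc_short hy0 hyx hp
  have hq : x / (2 * y) ≤ x / (4 * p) :=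
    div_le_div_of_nonneg_left hx (by positivity) (by linarith)
  have h1 : (y / p - 1) * (x / (2 * y)) ≤ (J.card : ℝ) * (x / (2 * y)) :=
    mul_le_mul_of_nonneg_right hcard hxy
  have hy' : 0 < y := by linarith
  have h2 : (y / p - 1) * (x / (2 * y)) = x / (2 * p) - x / (2 * y) := by
    field_simp
    try ring
  have h3 : x / (2 * p) = 2 * (x / (4 * p)) := by
    field_simp
    try ring
  linarith

/-- Height of the short-interval comparison sequence: `0 ≤ b_n ≤ x^η` once `x^{1−η} ≤ 2y`. -/
theorem shortInterval_height {x y η : ℝ} (hx : 0 < x) (hy : 0 < y) (hyx : x ^ (1 - η) / 2 ≤ y)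
    (t : ℝ) : 0 ≤ (Set.Ioc (x - y) x).indicator (fun _ : ℝ => x / (2 * y)) t ∧
      (Set.Ioc (x - y) x).indicator (fun _ : ℝ => x / (2 * y)) t ≤ x ^ η := by
  have hxy : 0 ≤ x / (2 * y) := by positivity
  have hle : x / (2 * y) ≤ x ^ η := by
    rw [div_le_iff₀ (by positivity)]
    have h1 : x = x ^ (1 - η) * x ^ η := by
      rw [← Real.rpow_add hx]; norm_num
    have h2 : x ^ (1 - η) * x ^ η ≤ 2 * y * x ^ η :=
      mul_le_mul_of_nonneg_right (by linarith) (Real.rpow_nonneg hx.le _)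
    calc x = x ^ (1 - η) * x ^ η := h1
      _ ≤ 2 * y * x ^ η := h2
      _ = x ^ η * (2 * y) := by ring
  by_cases ht : t ∈ Set.Ioc (x - y) x
  · rw [Set.indicator_of_mem ht]; exact ⟨hxy, hle⟩
  · rw [Set.indicator_of_notMem ht]
    exact ⟨le_rfl, Real.rpow_nonneg hx.le _⟩

/-- **Short intervals, Type II.**  For `0 ≤ θ`, `0 ≤ η`, `θ + η < c ≤ 1`, `ν > 0`, `B > 1` and all
large `x`: no real sequence `a` with at most `x^{1−c}` non-zero values on `(x/2, x]` has
`w = a − b` satisfying (II) in `[θ, θ + ν]` for ANY of Ford–Maynard's short-interval comparison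
sequences `b_n = x/(2y)·1_{x−y<n≤x}` with `x^{1−η}/2 ≤ y ≤ x/2` — unconditionally in `b`.
[cite: FordMaynard2024PrimeSieves, §2.4] [cite: FordMaynard2024PrimeSieves, §4.2 (Lemma 4.6)] -/
theorem eventually_not_typeII_shortInterval {c θ ν B η : ℝ} (hθ : 0 ≤ θ) (hη : 0 ≤ η)
    (hθc : θ + η < c) (hc1 : c ≤ 1) (hν : 0 < ν) (hB : 1 < B) :
    ∀ᶠ x : ℝ in atTop, ∀ (a : ℕ → ℝ) (A : Finset ℕ) (y : ℝ), (A.card : ℝ) ≤ x ^ (1 - c) →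
      (∀ v : ℕ, x / 2 < (v : ℝ) → (v : ℝ) ≤ x → a v ≠ 0 → v ∈ A) →
      x ^ (1 - η) / 2 ≤ y → y ≤ x / 2 →
      ¬ TypeII (fun n : ℕ => a n -
        (Set.Ioc (x - y) x).indicator (fun _ : ℝ => x / (2 * y)) (n : ℝ)) x θ ν B := by
  set κ : ℝ := (θ + (1 - η)) / 2 with hκdef
  have hκ : θ < κ := by rw [hκdef]; linarith
  have hκ' : κ < 1 - η := by rw [hκdef]; linarith
  filter_upwards [eventually_not_typeII_of_sparse_cmp_local hθ hη hθc hc1 hν hB hκ,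
    eventually_mul_rpow_le_rpow 4 hκ', eventually_ge_atTop (1 : ℝ)]
    with x hx e hx1 a A y hA hcov hy1 hy2
  have hx0 : 0 < x := by linarith
  have hxp : 0 < x ^ (1 - η) := Real.rpow_pos_of_pos hx0 _
  have hy0 : 0 < y := by linarith
  have hh := shortInterval_height (η := η) hx0 hy0 hy1
  refine hx a (fun n : ℕ => (Set.Ioc (x - y) x).indicator (fun _ : ℝ => x / (2 * y)) (n : ℝ))
    A ∅ hA hcov (fun n => (hh n).1) (fun n => (hh n).2) ?_ ?_
  · simp only [Finset.card_empty, Nat.cast_zero]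
    positivity
  · intro p hp _ _ hpκ
    have hpy : 2 * (p : ℝ) ≤ y := by linarith
    exact shortInterval_mass hp.pos hpy hy2

/-- **Short intervals, Type I.**  For `0 ≤ η`, `2η < c ≤ 1`, `γ > 1 − c + η`, `B > 1` and all
large `x`: no real sequence `a` with at most `x^{1−c}` non-zero values on `(x/2, x]` has
`w = a − b` satisfying (I) at level `x^γ` for any `b_n = x/(2y)·1_{x−y<n≤x}` with
`x^{1−η}/2 ≤ y ≤ x/2`.  (The hypothesis `2η < c` makes room for a prime scale between
`x^{1−c+η}` and `y`.) [cite: FordMaynard2024PrimeSieves, §2.4]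
[cite: FordMaynard2024PrimeSieves, §4.2 (Lemma 4.6)] -/
theorem eventually_not_typeI_shortInterval {c γ B η : ℝ} (hη : 0 ≤ η) (hη2 : 2 * η < c)
    (hc1 : c ≤ 1) (hγ : 1 - c + η < γ) (hB : 1 < B) :
    ∀ᶠ x : ℝ in atTop, ∀ (a : ℕ → ℝ) (A : Finset ℕ) (y : ℝ), (A.card : ℝ) ≤ x ^ (1 - c) →
      (∀ v : ℕ, x / 2 < (v : ℝ) → (v : ℝ) ≤ x → a v ≠ 0 → v ∈ A) →
      x ^ (1 - η) / 2 ≤ y → y ≤ x / 2 →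
      ¬ TypeI (fun n : ℕ => a n -
        (Set.Ioc (x - y) x).indicator (fun _ : ℝ => x / (2 * y)) (n : ℝ)) x γ B := by
  set κ : ℝ := ((1 - c + η) + (1 - η)) / 2 with hκdef
  have hκ : 1 - c + η < κ := by rw [hκdef]; linarith
  have hκ' : κ < 1 - η := by rw [hκdef]; linarith
  have hηc : η < c := by linarith
  filter_upwards [eventually_not_typeI_of_sparse_cmp_local hη hηc hc1 hγ hB hκ,
    eventually_mul_rpow_le_rpow 4 hκ', eventually_ge_atTop (1 : ℝ)]
    with x hx e hx1 a A y hA hcov hy1 hy2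
  have hx0 : 0 < x := by linarith
  have hxp : 0 < x ^ (1 - η) := Real.rpow_pos_of_pos hx0 _
  have hy0 : 0 < y := by linarith
  have hh := shortInterval_height (η := η) hx0 hy0 hy1
  refine hx a (fun n : ℕ => (Set.Ioc (x - y) x).indicator (fun _ : ℝ => x / (2 * y)) (n : ℝ))
    A ∅ hA hcov (fun n => (hh n).1) (fun n => (hh n).2) ?_ ?_
  · simp only [Finset.card_empty, Nat.cast_zero]
    positivity
  · intro p hp _ hpκ
    have hpy : 2 * (p : ℝ) ≤ y := by linarith
    exact shortInterval_mass hp.pos hpy hy2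

end Summit.Parity.BatemanHorn.Theorems

end
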